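import Literature.Geometry.Kaehler.ConnectionCurvatureGauge
import Literature.NumberTheory.Transcendental.ComplexFormsProofs
import Literature.Geometry.Kaehler.ChernCharacter
import HarnessLib

/-!
# Chern–Weil I proved: the Chern character forms of a connection on a cocycle are closed and glue

Layer `Literature/Geometry/Kaehler`. Sibling PROOF FILE of `ChernCharacter.lean`, discharging its
named fact `SmoothComplexVectorBundle.exists_isChernCharacterForm` ("Chern–Weil I", Kobayashi II
(2.3)–(2.4)): `SmoothComplexVectorBundle.exists_isChernCharacterForm_holds`. Fourth file of the
Chern–Weil package for `C^∞` complex vector bundles presented by cocycles (`ComplexVectorBundle`,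
`MatrixFormAlgebra`, `MatrixFormLocalCalculus`, `ConnectionCurvatureGauge`). Kobayashi, *Differential Geometry of
Complex Vector Bundles* (1987), Ch. II §2, proof of (2.4) "`d f(Ω) = 0`", verbatim in substance:
the Bianchi identity `dΩ = Ω ∧ ω - ω ∧ Ω` ((1.14)) gives `d(Ωᵏ) = Ωᵏ ∧ ω - ω ∧ Ωᵏ` by the
Leibniz rule, and the trace of a graded commutator vanishes, so `d tr(Ωᵏ) = 0`; with the frame
independence of `tr(Ωᵏ)` (Ch. II §1) the local forms `ch_k(E, D)|_{U_i} = (1/k!) tr((-Ω_i/2πi)ᵏ)`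
((2.21)) glue to a global closed form. All PROVED, pointwise at the points of `U_i`:

* `Connection.curvature_d_apply` — **Bianchi identity** `dΩ_i(x) = (Ω_i ∧ ω_i - ω_i ∧ Ω_i)(x)`;
* `Connection.npow_curvature_d_apply` — `d(Ω_iᵖ)(x) = (Ω_iᵖ ∧ ω_i - ω_i ∧ Ω_iᵖ)(x)`;
* `Connection.mextDeriv_trace_npow_curvature_apply` — `d tr(Ω_iᵖ)(x) = 0` (graded cyclicity of
  the trace, `MatrixForm.trace_wedge_comm`);
* `Connection.smoothAt_chernCharacterForm`, `Connection.mextDeriv_chernCharacterForm_apply` — the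
  local Chern character forms are smooth and closed at the points of `U_i`;
* `Connection.exists_isChernCharacterForm` — **for every connection `D` on a cocycle `V` and every
  `p` there is a global smooth closed `2p`-form `θ` with `IsChernCharacterForm D p θ`** (glue the
  local forms along the cover using `chernCharacterForm_apply_eq`). This is the non-vacuity of the
  Chern–Weil data consumed by `HolomorphicBundleChernCharacter` (`chernCharacterSet`), and it
  DISCHARGES the named fact `SmoothComplexVectorBundle.exists_isChernCharacterForm` of
  `ChernCharacter.lean` ("Chern–Weil I"): `SmoothComplexVectorBundle.exists_isChernCharacterForm_holds`
  (the binder `[FiniteDimensional ℂ E]` of the fact is not needed).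

## References

* S. Kobayashi, *Differential Geometry of Complex Vector Bundles* (1987), Ch. I §1 (1.14),
  Ch. II §1, §2 (2.4), (2.21).
-/

noncomputable section

open scoped Manifold ContDiff Topology Matrix
open Set Filter

namespace Literature.Geometry.Kaehler

/-! ### More algebra of matrices of forms -/

namespace MatrixForm

variable {E : Type*} [NormedAddCommGroup E] [NormedSpace ℝ E]
  {H : Type*} [TopologicalSpace H] {I : ModelWithCorners ℝ E H}
  {M : Type*} [TopologicalSpace M] [ChartedSpace H M] {r k l k' : ℕ}

/-- `(A - A') ∧ B = A ∧ B - A' ∧ B`. [cite: Kobayashi1987, Ch. I §1] -/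
theorem sub_wedge (A A' : MatrixForm I M r k) (B : MatrixForm I M r l) :
    (A - A').wedge B = A.wedge B - A'.wedge B := by
  rw [sub_eq_add_neg, add_wedge, neg_wedge, ← sub_eq_add_neg]

/-- `A ∧ (B - B') = A ∧ B - A ∧ B'`. [cite: Kobayashi1987, Ch. I §1] -/
theorem wedge_sub (A : MatrixForm I M r k) (B B' : MatrixForm I M r l) :
    A.wedge (B - B') = A.wedge B - A.wedge B' := by
  rw [sub_eq_add_neg, wedge_add, wedge_neg, ← sub_eq_add_neg]

/-- `d` commutes with degree casts of matrices of forms. [folklore] -/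
theorem d_castDeg (h : k = k') (A : MatrixForm I M r k) :
    (A.castDeg h).d = A.d.castDeg (congrArg (· + 1) h) := by
  subst h; rfl

/-- The identity matrix of `0`-forms is the `0`-form of the constant function `1`. [folklore] -/
theorem ofFun_const_one : ofFun (I := I) (fun _ : M ↦ (1 : Matrix (Fin r) (Fin r) ℂ)) = one := by
  ext a b x v : 3
  simp only [ofFun_apply, MForm.ofFun_apply, one, Matrix.diagonal_apply, Matrix.one_apply]
  split_ifs <;> rfl

/-- `1 ∧ A = A` up to the cast along `0 + k = k`. [cite: Kobayashi1987, Ch. II §2 (2.21)] -/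
theorem one_wedge (A : MatrixForm I M r k) : one.wedge A = A.castDeg (Nat.zero_add k).symm := by
  rw [← ofFun_const_one, ofFun_wedge]
  congr 1
  ext a b x : 2
  exact mulLeft_apply_of_eq_one (g := fun _ : M ↦ (1 : Matrix (Fin r) (Fin r) ℂ)) (x := x) rfl A a b

/-- `A ∧ 1 = A` (the degree `k + 0` is `k`). [cite: Kobayashi1987, Ch. II §2 (2.21)] -/
theorem wedge_one (A : MatrixForm I M r k) : A.wedge one = A := by
  rw [← ofFun_const_one, wedge_ofFun]
  ext a b x : 2
  exact mulRight_apply_of_eq_one (g := fun _ : M ↦ (1 : Matrix (Fin r) (Fin r) ℂ)) (x := x) rfl A a b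

/-- The entries of `1` have vanishing exterior derivative. [folklore] -/
theorem one_d_apply (a b : Fin r) (x : M) : (one : MatrixForm I M r 0).d a b x = 0 := by
  rw [d_apply, one, Matrix.diagonal_apply]
  split_ifs
  · rw [mextDeriv_ofFun_const]; rfl
  · rw [mextDeriv_zero]; rfl

end MatrixForm

/-! ### Bianchi, `d(Ωᵖ)`, closedness of `tr(Ωᵖ)` -/

namespace SmoothComplexVectorBundle

namespace Connection

variable {ι : Type*} {E : Type*} [NormedAddCommGroup E] [NormedSpace ℂ E]
  {M : Type*} [TopologicalSpace M] [ChartedSpace E M] {r : ℕ}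
  {V : SmoothComplexVectorBundle ι E M r} (D : V.Connection) [IsManifold 𝓘(ℝ, E) ∞ M]

/-- **Bianchi identity, Kobayashi (1.14)**: at a point `x ∈ U_i`,
`dΩ_i(x) = (Ω_i ∧ ω_i - ω_i ∧ Ω_i)(x)` (the second term cast along `1 + 2 = 2 + 1`):
`dΩ = d(dω + ω ∧ ω) = dω ∧ ω - ω ∧ dω` (`dd = 0`, Leibniz), while
`Ω ∧ ω - ω ∧ Ω = dω ∧ ω + (ω ∧ ω) ∧ ω - ω ∧ dω - ω ∧ (ω ∧ ω)` and `∧` is associative.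
[cite: Kobayashi1987, Ch. I §1 (1.14)] -/
theorem curvature_d_apply {i : ι} {x : M} (hi : x ∈ V.baseSet i) (a b : Fin r) :
    (D.curvature i).d a b x =
      ((D.curvature i).wedge (D.form i) -
        ((D.form i).wedge (D.curvature i)).castDeg (Nat.add_comm 1 2)) a b x := by
  have hw := D.smoothAt_form hi
  have hdw := D.smoothAt_form_d hi
  have hww : ∀ c d, ((D.form i).wedge (D.form i) c d).SmoothAt x := MatrixForm.smoothAt_wedge hw hw
  have hdd : (D.form i).d.d a b x = 0 := by
    rw [MatrixForm.d_apply, MatrixForm.d_apply]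
    exact mextDeriv_mextDeriv_of_smoothAt (D.eventually_smoothAt_form hi a b)
  rw [curvature, MatrixForm.d_add_apply hdw hww, hdd, zero_add, MatrixForm.d_wedge_apply hw hw,
    MatrixForm.castDeg_eq_self, pow_one, neg_one_smul, MatrixForm.add_wedge, MatrixForm.wedge_add,
    MatrixForm.wedge_assoc, MatrixForm.castDeg_eq_self, MatrixForm.castDeg_add,
    MatrixForm.castDeg_eq_self, MatrixForm.castDeg_eq_self]
  simp only [Matrix.add_apply, Matrix.sub_apply, Matrix.neg_apply, Pi.add_apply, Pi.sub_apply,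
    Pi.neg_apply]
  abel

/-- **`d(Ωᵖ) = Ωᵖ ∧ ω - ω ∧ Ωᵖ` at the points of `U_i`** (the second term cast along
`1 + 2p = 2p + 1`), by induction on `p` from the Bianchi identity and the Leibniz rule:
`d(Ωᵖ ∧ Ω) = dΩᵖ ∧ Ω + Ωᵖ ∧ dΩ = (Ωᵖ ∧ ω - ω ∧ Ωᵖ) ∧ Ω + Ωᵖ ∧ (Ω ∧ ω - ω ∧ Ω)`, in which
`Ωᵖ ∧ ω ∧ Ω` cancels (associativity). This is the telescoping step of the proof of Kobayashi (2.4).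
[cite: Kobayashi1987, Ch. II §2 (2.4)] -/
theorem npow_curvature_d_apply {i : ι} {x : M} (hi : x ∈ V.baseSet i) (p : ℕ) (a b : Fin r) :
    (MatrixForm.npow (D.curvature i) p).d a b x =
      ((MatrixForm.npow (D.curvature i) p).wedge (D.form i) -
        ((D.form i).wedge (MatrixForm.npow (D.curvature i) p)).castDeg (Nat.add_comm 1 (2 * p))) a b x := by
  set Ω := D.curvature i with hΩdef
  set w := D.form i with hwdef
  have hws : ∀ c d, (w c d).SmoothAt x := D.smoothAt_form hi
  have hΩs : ∀ c d, (Ω c d).SmoothAt x := D.smoothAt_curvature hi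
  induction p generalizing a b with
  | zero =>
    rw [MatrixForm.npow_zero, MatrixForm.one_d_apply, Matrix.sub_apply, Pi.sub_apply,
      MatrixForm.one_wedge, MatrixForm.wedge_one, MatrixForm.castDeg_eq_self, sub_self]
  | succ p ih =>
    have hXs : ∀ c d, (MatrixForm.npow Ω p c d).SmoothAt x := D.smoothAt_npow_curvature hi p
    rw [MatrixForm.npow_succ]
    -- the left-hand side
    have hx1 : ((MatrixForm.npow Ω p).wedge Ω).d a b x =
        (((MatrixForm.npow Ω p).d.wedge Ω).castDeg (Nat.add_right_comm (2 * p) 1 2) +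
          ((-1 : ℝ) ^ (2 * p)) • (MatrixForm.npow Ω p).wedge Ω.d) a b x := by
      rw [MatrixForm.d_wedge_apply hXs hΩs, Matrix.add_apply, Pi.add_apply]
    have hsign : ((-1 : ℝ) ^ (2 * p)) = 1 := by rw [pow_mul, neg_one_sq, one_pow]
    have hL1 : (((MatrixForm.npow Ω p).d.wedge Ω).castDeg (by omega : 2 * p + 1 + 2 = 2 * (p + 1) + 1)) a b x =
        (((MatrixForm.npow Ω p).wedge (w.wedge Ω)).castDeg (by omega : 2 * p + (1 + 2) = 2 * (p + 1) + 1)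
          - (w.wedge ((MatrixForm.npow Ω p).wedge Ω)).castDeg (by omega : 1 + (2 * p + 2) = 2 * (p + 1) + 1))
          a b x := by
      rw [MatrixForm.castDeg_apply,
        MForm.castDeg_apply_eq _ (MatrixForm.wedge_apply_congr
          (A' := (MatrixForm.npow Ω p).wedge w - (w.wedge (MatrixForm.npow Ω p)).castDeg (Nat.add_comm 1 (2 * p)))
          (B' := Ω) (fun c ↦ ih a c) (fun _ ↦ rfl)),
        ← MatrixForm.castDeg_apply, MatrixForm.sub_wedge, MatrixForm.castDeg_sub,
        MatrixForm.castDeg_wedge, MatrixForm.wedge_assoc, MatrixForm.wedge_assoc,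
        MatrixForm.castDeg_castDeg, MatrixForm.castDeg_castDeg, MatrixForm.castDeg_castDeg]
    have hL2 : (((MatrixForm.npow Ω p).wedge Ω.d).castDeg (by omega : 2 * p + (2 + 1) = 2 * (p + 1) + 1)) a b x =
        (((MatrixForm.npow Ω p).wedge (Ω.wedge w)).castDeg (by omega : 2 * p + (2 + 1) = 2 * (p + 1) + 1)
          - ((MatrixForm.npow Ω p).wedge (w.wedge Ω)).castDeg (by omega : 2 * p + (1 + 2) = 2 * (p + 1) + 1))
          a b x := by
      rw [MatrixForm.castDeg_apply,
        MForm.castDeg_apply_eq _ (MatrixForm.wedge_apply_congr (A' := MatrixForm.npow Ω p)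
          (B' := Ω.wedge w - (w.wedge Ω).castDeg (Nat.add_comm 1 2)) (fun _ ↦ rfl)
          (fun c ↦ D.curvature_d_apply hi c b)),
        ← MatrixForm.castDeg_apply, MatrixForm.wedge_sub, MatrixForm.castDeg_sub,
        MatrixForm.wedge_castDeg, MatrixForm.castDeg_castDeg]
    have hL : (((MatrixForm.npow Ω p).wedge Ω).castDeg (by omega : 2 * p + 2 = 2 * (p + 1))).d a b x =
        ((((MatrixForm.npow Ω p).wedge (w.wedge Ω)).castDeg (by omega : 2 * p + (1 + 2) = 2 * (p + 1) + 1)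
          - (w.wedge ((MatrixForm.npow Ω p).wedge Ω)).castDeg (by omega : 1 + (2 * p + 2) = 2 * (p + 1) + 1))
          a b x) +
        ((((MatrixForm.npow Ω p).wedge (Ω.wedge w)).castDeg (by omega : 2 * p + (2 + 1) = 2 * (p + 1) + 1)
          - ((MatrixForm.npow Ω p).wedge (w.wedge Ω)).castDeg (by omega : 2 * p + (1 + 2) = 2 * (p + 1) + 1))
          a b x) := by
      rw [MatrixForm.d_castDeg, MatrixForm.castDeg_apply, MForm.castDeg_apply_eq _ hx1,
        ← MatrixForm.castDeg_apply, MatrixForm.castDeg_add, MatrixForm.castDeg_castDeg,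
        MatrixForm.castDeg_smul, hsign, one_smul, Matrix.add_apply, Pi.add_apply, hL1, hL2]
    -- the right-hand side
    have hR1 : ((((MatrixForm.npow Ω p).wedge Ω).castDeg (by omega : 2 * p + 2 = 2 * (p + 1))).wedge w) a b x =
        (((MatrixForm.npow Ω p).wedge (Ω.wedge w)).castDeg (by omega : 2 * p + (2 + 1) = 2 * (p + 1) + 1)) a b x := by
      rw [MatrixForm.castDeg_wedge, MatrixForm.wedge_assoc, MatrixForm.castDeg_castDeg]
    have hR2 : ((w.wedge (((MatrixForm.npow Ω p).wedge Ω).castDeg (by omega : 2 * p + 2 = 2 * (p + 1)))).castDeg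
          (Nat.add_comm 1 (2 * (p + 1)))) a b x =
        ((w.wedge ((MatrixForm.npow Ω p).wedge Ω)).castDeg (by omega : 1 + (2 * p + 2) = 2 * (p + 1) + 1)) a b x := by
      rw [MatrixForm.wedge_castDeg, MatrixForm.castDeg_castDeg]
    rw [hL]
    simp only [Matrix.sub_apply, Pi.sub_apply]
    rw [hR1, hR2]
    abel

/-- **`d tr(Ωᵖ) = 0` at the points of `U_i` (Kobayashi (2.4))**: `d tr(Ωᵖ) = tr(Ωᵖ ∧ ω - ω ∧ Ωᵖ)`
and the trace of the graded commutator of a matrix of `2p`-forms with a matrix of `1`-forms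
vanishes (`MatrixForm.trace_wedge_comm`). [cite: Kobayashi1987, Ch. II §2 (2.4)] -/
theorem mextDeriv_trace_npow_curvature_apply {i : ι} {x : M} (hi : x ∈ V.baseSet i) (p : ℕ) :
    mextDeriv (MatrixForm.npow (D.curvature i) p).trace x = 0 := by
  have hXs : ∀ c d, (MatrixForm.npow (D.curvature i) p c d).SmoothAt x :=
    D.smoothAt_npow_curvature hi p
  have hsign : ((-1 : ℝ) ^ (1 * (2 * p))) = 1 := by rw [one_mul, pow_mul, neg_one_sq, one_pow]
  have htr : ((MatrixForm.npow (D.curvature i) p).wedge (D.form i)).trace =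
      (((D.form i).wedge (MatrixForm.npow (D.curvature i) p)).castDeg (Nat.add_comm 1 (2 * p))).trace := by
    rw [MatrixForm.trace_wedge_comm, hsign, one_smul, MatrixForm.trace_castDeg]
  simp only [Matrix.trace, Matrix.diag_apply] at htr ⊢
  rw [mextDeriv_sum_apply_of_smoothAt _ fun a _ ↦ hXs a a]
  have h : ∀ a, mextDeriv (MatrixForm.npow (D.curvature i) p a a) x =
      ((MatrixForm.npow (D.curvature i) p).wedge (D.form i)) a a x -
        (((D.form i).wedge (MatrixForm.npow (D.curvature i) p)).castDeg (Nat.add_comm 1 (2 * p))) a a x :=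
    fun a ↦ by rw [← MatrixForm.d_apply, D.npow_curvature_d_apply hi p a a, Matrix.sub_apply, Pi.sub_apply]
  simp only [h, Finset.sum_sub_distrib, ← Finset.sum_apply, htr, sub_self]

omit [IsManifold 𝓘(ℝ, E) ∞ M] in
/-- Complex scalar multiples of a form smooth at `x` are smooth at `x`. [folklore] -/
theorem _root_.Literature.Geometry.Kaehler.MForm.SmoothAt.smul_complex {k : ℕ} (c : ℂ)
    {α : MForm 𝓘(ℝ, E) M ℂ k} {x : M} (hα : α.SmoothAt x) : (c • α).SmoothAt x := by
  rw [MForm.SmoothAt, MForm.inChart_smul_complex]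
  exact ContDiffWithinAt.const_smul c hα

/-- The local Chern character form `ch_p(E, D)|_{U_i}` is smooth at the points of `U_i`.
[cite: Kobayashi1987, Ch. II §2 (2.21)] -/
theorem smoothAt_chernCharacterForm {i : ι} {x : M} (hi : x ∈ V.baseSet i) (p : ℕ) :
    (D.chernCharacterForm p i).SmoothAt x := by
  rw [chernCharacterForm]
  refine MForm.SmoothAt.smul_complex _ ?_
  simp only [Matrix.trace, Matrix.diag_apply]
  exact MForm.smoothAt_sum _ fun a _ ↦ D.smoothAt_npow_curvature hi p a a

/-- **The local Chern character forms are closed at the points of `U_i`**: `d ch_p(E, D)|_{U_i}(x) = 0`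
(`d` is `ℂ`-linear, `mextDeriv_smul_complex_holds`, and `d tr(Ωᵖ) = 0`, Kobayashi (2.4)).
[cite: Kobayashi1987, Ch. II §2 (2.4)] -/
theorem mextDeriv_chernCharacterForm_apply {i : ι} {x : M} (hi : x ∈ V.baseSet i) (p : ℕ) :
    mextDeriv (D.chernCharacterForm p i) x = 0 := by
  rw [chernCharacterForm, Literature.NumberTheory.Transcendental.mextDeriv_smul_complex_holds,
    Pi.smul_apply, D.mextDeriv_trace_npow_curvature_apply hi p, smul_zero]

/-- **Existence of global Chern character forms (Chern–Weil, Kobayashi II (2.4) with Ch. II §1).**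
For every connection `D` on a `C^∞` complex vector bundle presented by a cocycle and every `p`,
there is a global smooth closed `2p`-form `θ` which is a `p`-th Chern character form of `(V, D)`
(`IsChernCharacterForm`: it agrees on every `U_i` with `ch_p(E, D)` computed in the frame `s_i`):
glue the local forms — they agree on overlaps (`chernCharacterForm_apply_eq`) and are smooth and
closed at the points of their charts. [cite: Kobayashi1987, Ch. II §2 (2.4) and (2.21)] -/
theorem exists_isChernCharacterForm (p : ℕ) :
    ∃ θ : MForm 𝓘(ℝ, E) M ℂ (2 * p),
      IsSmoothForm θ ∧ IsClosedForm θ ∧ D.IsChernCharacterForm p θ := by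
  choose idx hidx using V.exists_mem_baseSet
  have hloc : ∀ x, ∀ᶠ y in 𝓝 x, (fun y ↦ D.chernCharacterForm p (idx y) y : MForm 𝓘(ℝ, E) M ℂ (2 * p)) y =
      D.chernCharacterForm p (idx x) y := fun x ↦ by
    filter_upwards [(V.isOpen_baseSet (idx x)).mem_nhds (hidx x)] with y hy
    exact D.chernCharacterForm_apply_eq hy (hidx y) p
  refine ⟨fun y ↦ D.chernCharacterForm p (idx y) y, fun x ↦ ?_, ?_, fun i x hx ↦ ?_⟩
  · exact (D.smoothAt_chernCharacterForm (hidx x) p).congr_of_eventuallyEq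
      ((hloc x).mono fun y hy ↦ hy.symm)
  · funext x
    rw [mextDeriv_congr_of_eventuallyEq (hloc x), Pi.zero_apply]
    exact D.mextDeriv_chernCharacterForm_apply (hidx x) p
  · exact D.chernCharacterForm_apply_eq hx (hidx x) p

end Connection

section Discharge

variable (E : Type*) [NormedAddCommGroup E] [NormedSpace ℂ E] [FiniteDimensional ℂ E]
  (M : Type*) [TopologicalSpace M] [ChartedSpace E M]

/-- **Discharge of the named fact `SmoothComplexVectorBundle.exists_isChernCharacterForm`
("Chern–Weil I", `ChernCharacter.lean`; Kobayashi, Ch. II §2 (2.3)–(2.4)):** the local Chern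
character forms of every connection on every cocycle-presented `C^∞` complex vector bundle glue to a
global smooth closed form — `Connection.exists_isChernCharacterForm`.
[cite: Kobayashi1987, Ch. II §2 (2.3)–(2.4)] -/
theorem exists_isChernCharacterForm_holds : exists_isChernCharacterForm E M := by
  intro _ ι r V D k
  exact D.exists_isChernCharacterForm k

end Discharge

end SmoothComplexVectorBundle

end Literature.Geometry.Kaehler

end
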